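import Mathlib

/-!
# Route ConvexRankGates — crux `LinAlgGateBlind` (stmt-PneNP-10681), support:
# cliques of a graph supported on a `k`-partition are transversals

The planting step of the registered stub `stub_transfer` of line `perm-door-lifted-closure-programs`
(lifted CSP-SAT as a monotone projection of `CLIQUE(m, k)`) uses the folklore combinatorics of the
FGLSS / compatibility graph: when the vertices are coloured by `k` groups (hub, dummies, one group per
constraint) and edges only join DIFFERENT groups, a `k`-clique is exactly a choice of one vertex per
group, pairwise adjacent. This file proves that statement in Mathlib vocabulary, definition-free:

* `injOn_of_isClique` — a group map that separates adjacent vertices is injective on every clique.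
* `not_cliqueFree_iff_exists_transversal` — for `G : SimpleGraph V` and `grp : V → Fin k` with
  `G.Adj u v → grp u ≠ grp v`: `¬ G.CliqueFree k ↔ ∃ f : Fin k → V, (∀ i, grp (f i) = i) ∧
  ∀ i j, i ≠ j → G.Adj (f i) (f j)`.

[folklore; Feige–Goldwasser–Lovász–Safra–Szegedy 1996 (the FGLSS graph), Karp 1972 (SAT ≤ CLIQUE)]
-/

namespace Summit.PneNP.PneNP.Theorems

open Finset

/-- A group map separating adjacent vertices is injective on every clique. [folklore] -/
theorem injOn_of_isClique {V : Type*} {k : ℕ} (G : SimpleGraph V) (grp : V → Fin k)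
    (hgrp : ∀ u v, G.Adj u v → grp u ≠ grp v) {s : Set V} (hs : G.IsClique s) : Set.InjOn grp s :=
  fun u hu v hv huv => by_contra fun hne => hgrp u v (hs hu hv hne) huv

/-- **Cliques of a graph supported on a `k`-partition are transversals.** If `grp : V → Fin k`
separates adjacent vertices of `G` (no edge inside a group), then `G` contains a `k`-clique iff one
can choose one vertex in every group, pairwise adjacent. [folklore] -/
theorem not_cliqueFree_iff_exists_transversal : ∀ {V : Type} {k : ℕ} (G : SimpleGraph V)
    (grp : V → Fin k), (∀ u v, G.Adj u v → grp u ≠ grp v) →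
    (¬ G.CliqueFree k ↔ ∃ f : Fin k → V, (∀ i, grp (f i) = i) ∧ ∀ i j, i ≠ j → G.Adj (f i) (f j)) := by
  intro V k G grp hgrp
  classical
  constructor
  · intro h
    simp only [SimpleGraph.CliqueFree, not_forall, not_not] at h
    obtain ⟨s, hs⟩ := h
    have hcl : G.IsClique (s : Set V) := hs.isClique
    have hcard : s.card = k := hs.card_eq
    have hinj : Set.InjOn grp (s : Set V) := injOn_of_isClique G grp hgrp hcl
    -- `grp` restricted to `s` is a bijection onto `Fin k`
    have himg : s.image grp = univ := by
      apply eq_univ_of_card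
      rw [card_image_of_injOn (by simpa using hinj), hcard, Fintype.card_fin]
    have hsurj : ∀ i : Fin k, ∃ v ∈ s, grp v = i := fun i => by
      have : i ∈ s.image grp := himg ▸ mem_univ i
      simpa [mem_image] using this
    choose f hf hgf using hsurj
    refine ⟨f, hgf, fun i j hij => hcl (hf i) (hf j) fun h => hij ?_⟩
    rw [← hgf i, ← hgf j, h]
  · rintro ⟨f, hgf, hadj⟩
    have hinj : Function.Injective f := fun i j h => by
      by_contra hij
      exact (hadj i j hij).ne h
    intro hfree
    refine hfree (univ.image f) ⟨?_, ?_⟩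
    · intro u hu v hv huv
      simp only [coe_image, coe_univ, Set.image_univ, Set.mem_range] at hu hv
      obtain ⟨i, rfl⟩ := hu
      obtain ⟨j, rfl⟩ := hv
      exact hadj i j fun h => huv (h ▸ rfl)
    · rw [card_image_of_injective _ hinj, card_fin]

end Summit.PneNP.PneNP.Theorems
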